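import Summits.HodgeConjecture.HodgeConjecture.Theorems.F0P3cS2SharpOrgansOfS2Sharp      -- ★ p848004 ED. 1 certificate: `s2Fin_of_S2sharp`, `s2PinIota_of_S2sharp`, `s2PinCompact_of_S2sharp`, `s2sharp_of_organs` (+ ★ S2♯, K_c, U♭-cot, K4 token)
import Summits.HodgeConjecture.HodgeConjecture.Theorems.F0P3cArchTokenCohomological     -- «Tok» (LH1-p04 (g3)): `exists_upqTypeClasses_ne_bot_of_token_cpt` — every token of a cotangent `P` is cohomological
import Summits.HodgeConjecture.HodgeConjecture.Theorems.F0P3cRogTripleChiArithmetic      -- ★ p849139 «Aχ»: `rogCasimirScalar`, `rogCentralSum`, `aχ_isCohTrivial_of_chi`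
import Literature.RepresentationTheory.BorelWallach2000.GKCohomologyCentralCharacter      -- ★ p849137 (b1): `upq_I_smul_one_mem_lie`, `upqTypeClasses_eq_bot_of_center_eq_smul ∕ _of_upqCasimirOp_eq_smul` (χ-Wigner bridge)
import Summits.HodgeConjecture.HodgeConjecture.Theorems.F0P3cWignerCasimirCentral       -- ★ p849350 «Wχ» (LH1-p01 (g3)): W4 `wχ_casimir_and_central_eq_zero_of_typeClasses_ne_bot` (★ Dixmier–Schur, no admissibility + ★ (b1))
import HarnessLib

/-!
# Crux `H413`, half A line LH1 — THE EQUIVALENCE CERTIFICATE for LEAF ED. 2 «χ» of the pay-down of the closer stub `stub_S2sharp`: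
# S2♯ (#80) ⟺ FIN ∧ GLOBAL-ι^χ ∧ PIN-τ, and GLOBAL-ι^χ ⟺ PIN-ι (ED. 1's organ), BY THEOREM

Cell `hodgecm-mathlib` (D-0151), FLOOR 0, crux item H413 = `stmt-HodgeConjecture-24833` (`--supports`), route of record `HCCMUnconditional`; half A line LH1,
prover LH1-p04 (g3), DEAL #3 (iv) «Cert» of LH1-plan (g4) 2026-09-02T04:26:40Z (desk ruling D62-pre «χ» (c6)).  THEOREMS ONLY (no `def`, no instance, no notation,
no named fact, no `sorry`); never imports a `Cruxes/…/Lines` module.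

THE OBJECTS.  LEAF `Cruxes/H413/Lines/F0_P3c_S2SharpPaydown.lean` ED. 1 (10355e03d0b94504) cut the print letter S2♯ ★ `cohDiscrete_memXiFamily_archPinned`
(#80) into FIN · PIN-ι · PIN-τ, and ★ `F0P3cS2SharpOrgansOfS2Sharp` certified `S2♯ ↔ FIN ∧ PIN-ι ∧ PIN-τ`.  ED. 2 «χ» (LH1-plan (g4) CAND
`StubS2sharp.paydown.skeleton.v3.cand`, organ text FROZEN = v3pre2 :198–:232) replaces PIN-ι by **GLOBAL-ι^χ**: at PIN-ι's frame MINUS the `K_c` clause and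
MINUS the `H¹_δ ≠ ⊥` antecedent (desk (c3)), for EVERY irreducible `(𝔤,K)`-token `(M, σK, σ𝔤)` of `P.archModuleCM ι T hT` and every `ξ` of the family, with
`(a,b,c) = rogTriple (ξ.pη ι) (ξ.qψ ι) (tOfArchType k₀ ι)`: the trace-form Casimir ★ `upqCasimirOp σ𝔤` acts on `M` by `κ = a²+b²+c²−2` and every `Z ∈ 𝔲(2,1)`
with `↑Z = i·1` by `±i(a+b+c)`.  The ED. 2 head derives PIN-ι from GLOBAL-ι^χ (χ-currency Wigner step, ★ p849137 (b1) + ★ p849139 «Aχ»).  THIS FILE proves the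
CONVERSE legs in-house, so the books may read row #80 ≡ FIN + GLOBAL-ι^χ + PIN-τ and LH-ref1's «not weaker ∕ not stronger» box R-χ closes by theorem:
* §1 (pointwise, compact CM datum) `globalChi_of_isCohTrivialAt` — THE CONVERSE WIGNER STEP: for a cotangent `P` and ANY irreducible token `M` of `P`,
  `ξ.IsCohTrivialAt t ι` ⟹ the GLOBAL-ι^χ conclusion for `(M, ξ, t)`.  `IsCohTrivialAt` IS `rogTriple … = (1,0,−1)` (★ `OneDimAutRepH`), so `κ = 0 = a+b+c`;
  the token `M` is COHOMOLOGICAL (`H¹_δ(M) ≠ ⊥`, some `δ = ±1`) by «Tok» `exists_upqTypeClasses_ne_bot_of_token_cpt` (★ K4 token + ★ token seam over F1a-CM + ★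
  type functoriality); the Casimir and every scalar `Z` act on the irreducible `M` by scalars which a non-zero `H¹_δ(M)` forces to VANISH («Wχ» W4 ★ p849350
  `wχ_casimir_and_central_eq_zero_of_typeClasses_ne_bot`: ★ Dixmier–Schur without admissibility + ★ (b1) BW II Cor. 3.3 ∕ I Thm. 5.3 (ii)) — witness `s = 0`.
  `isCohTrivialAt_of_globalChi` — Theorems-side twin of the leaf's χ-Wigner bridge (GLOBAL-ι^χ conclusion + `H^n_δ ≠ ⊥` ⟹ `IsCohTrivialAt`).
* §2 `globalIotaChi_of_pinIota : ‹PIN-ι› → ‹GLOBAL-ι^χ›` (PIN-ι at the cohomological token of ★ K4, then §1) and `pinIota_of_globalIotaChi : ‹GLOBAL-ι^χ› → ‹PIN-ι›`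
  (the leaf's `ι`-branch, organ-to-organ) — **ED. 2's organ ≡ ED. 1's organ modulo ★**.
* §3 `s2GlobalIotaChi_of_S2sharp : S2♯ → ‹GLOBAL-ι^χ›` (= §2 ∘ ★ `s2PinIota_of_S2sharp`; S2♯'s `K_c` clause discharged for the cotangent `P` by ★ p819716 inside
  the ED. 1 leg) — desk (c6): GLOBAL-ι^χ is NOT STRONGER than print-plus-★ even without the `H¹` antecedent.
* §4 `s2sharp_iff_organsChi : S2♯ ↔ ‹FIN› ∧ ‹GLOBAL-ι^χ› ∧ ‹PIN-τ›` — THE CERTIFICATE (⟸ = ★ ED. 1 head `s2sharp_of_organs` after §2; ⟹ = ★ read-backs + §3);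
  `s2sharp_iff_organsChi.2 ⟨hFin, hChi, hCpt⟩` is the hypothesis-free carrier `… : cohDiscrete_memXiFamily_archPinned` the day the three organs are ★; with ★
  `s2sharp_iff_organs`: `FIN ∧ GLOBAL-ι^χ ∧ PIN-τ ↔ S2♯ ↔ FIN ∧ PIN-ι ∧ PIN-τ`.
Organ texts are the leaf's bodies TOKEN FOR TOKEN as explicit `∀`-telescopes (FIN ∕ PIN-ι ∕ PIN-τ = ED. 1 = the ★ certificate's; GLOBAL-ι^χ = the frozen text).
Nothing printed is discharged: FIN ∕ GLOBAL-ι^χ ∕ PIN-τ stay rung-5 print ([Rogawski1990] Thm. 13.3.5, 13.3.6 (c), 14.6.4, §12.2–12.3 + [KnappVogan1995] Prop. 4.120 ∕ 11.43).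
HONEST LABEL: HC_CM is proved only modulo the 7 printed citations (2 remaining: hLiu418 = stmt-HodgeConjecture-24832, h413 = stmt-HodgeConjecture-24833)
until rung 0 closes.
References: [Rogawski1990] J. Rogawski, *Automorphic representations of unitary groups in three variables* (1990): §12.2–12.3 pp. 174–178 (Prop. 12.3.3),
§13.1, Thm. 13.3.5, 13.3.6 (c), §14.6 (Thm. 14.6.4), Prop. 15.2.1, §15.3 ¶1; [BorelWallach2000] A. Borel, N. Wallach, *Continuous cohomology, discrete subgroups,
and representations of reductive groups*, 2nd ed. (2000): I Thm. 5.3 (ii), II §1.3, II Cor. 3.3, II §4.2 (3), II Thm. 4.8, VI Thm. 4.11; [KnappVogan1995] A. Knapp,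
D. Vogan, *Cohomological induction and unitary representations* (1995), Prop. 4.87, 4.120, 11.43; [FlathCorvallis1979] Thm. 3–4; [Liu2021] Remark 4.2.
-/

-- Mathlib idiom (as in ★ `F0P3cS2SharpOrgansOfS2Sharp`): commutator bracket on `Module.End ℂ M`, load-bearing for the binder `→ₗ⁅ℝ⁆ Module.End ℂ M`.
attribute [local instance 100] LieRing.ofAssociativeRing

set_option autoImplicit false
set_option linter.dupNamespace false -- the mandated namespace repeats `HodgeConjecture.HodgeConjecture`

noncomputable section
open NumberField IsDedekindDomain MeasureTheory
open scoped Matrix ComplexOrder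

namespace Summit.HodgeConjecture.HodgeConjecture.Cruxes.H413.F0P3cS2SharpOrgansOfS2SharpChi

open Literature.NumberTheory.Automorphic Literature.NumberTheory.Automorphic.UnitaryGroup
open Literature.NumberTheory.Automorphic.UnitaryGroup.CotangentForms
open Literature.NumberTheory.GaloisRepresentations
open Literature.NumberTheory.Rogawski1990
open Literature.RepresentationTheory.BorelWallach2000
open Literature.RepresentationTheory.KonnoKonno2007 Literature.RepresentationTheory.KonnoKonno2007.RealDualPair
open Literature.RepresentationTheory.KonnoKonno2007.RealDualPair.UForm
open Summit.HodgeConjecture.HodgeConjecture.Cruxes.H413.F0P3XiArchDataOfRecord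
open Summit.HodgeConjecture.HodgeConjecture.Cruxes.H413.F0P3cRogTripleChiArithmetic
open Summit.HodgeConjecture.HodgeConjecture.Cruxes.H413.F0P3cArchTokenCohomological (exists_upqTypeClasses_ne_bot_of_token_cpt)
open Summit.HodgeConjecture.HodgeConjecture.Cruxes.H413.F0P3cWignerCasimirCentral (wχ_casimir_and_central_eq_zero_of_typeClasses_ne_bot)
open Summit.HodgeConjecture.HodgeConjecture.Cruxes.H413.F0P3cS2SharpOrgansOfS2Sharp
open Summit.HodgeConjecture.HodgeConjecture.Cruxes.H413.F0P3SLayerFoldShapes (exists_cohToken_of_isHolOrAntihol_cpt)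

/-! ## §1 The converse Wigner step at a token of a cotangent `P` (pointwise, compact CM datum), and the Theorems-side χ-Wigner bridge -/

section Pointwise

variable (L : Type) [Field L] [NumberField L] [IsCMField L] (ι : L →+* ℂ) (H : Matrix (Fin 3) (Fin 3) L) (T : GL (Fin 3) ℂ)
  (hT : (T : Matrix (Fin 3) (Fin 3) ℂ)ᴴ * H.map ι * (T : Matrix (Fin 3) (Fin 3) ℂ) = Literature.Geometry.ComplexHyperbolic.BallModel.J)
  (μ : Measure (adelicGroupData (↥(maximalRealSubfield L)) L (IsCMField.complexConj L) 3 H).automorphicQuotient)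
  [(adelicGroupData (↥(maximalRealSubfield L)) L (IsCMField.complexConj L) 3 H).IsAutomorphicMeasure μ]
  {M : Type} [AddCommGroup M] [Module ℂ M]
  {σK : Representation ℂ (uFormGroup (Fin 2) (Fin 1)).maximalCompact M}
  {σ𝔤 : (uFormGroup (Fin 2) (Fin 1)).lie →ₗ⁅ℝ⁆ Module.End ℂ M}

/-- **THE CONVERSE WIGNER STEP (pointwise).**  Compact CM datum, `P` discrete of (anti)holomorphic cotangent type at the CM frame, `(M, σK, σ𝔤)` ANY
irreducible `(𝔤,K)`-module receiving a non-zero `(𝔤,K)`-map from `P.archModuleCM ι T hT`: if `ξ.IsCohTrivialAt t ι` (i.e. `rogTriple … = (1,0,−1)`) and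
`rogTriple … = (a,b,c)`, the Casimir acts on `M` by `((a²+b²+c²−2 : ℤ) : ℂ)` (`= 0`) and every `Z` with `↑Z = i·1` by `(s : ℂ)·i`, `s = a+b+c` (`= 0`).
PROOF: `M` is cohomological («Tok» ★ p849210), and on an irreducible module with `H¹_δ ≠ ⊥` the Casimir and every scalar `Z` act by zero («Wχ» W4 ★ p849350:
Dixmier–Schur without admissibility + BW II Cor. 3.3 ∕ I Thm. 5.3 (ii) ★ p849137). [cite: BorelWallach2000, II Cor. 3.3; I §5.3; II §4.2 (3)] [cite: KnappVogan1995, Prop. 4.87] [cite: Rogawski1990, Prop. 15.2.1 (b) (p. 249); §12.3 p. 178] -/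
theorem globalChi_of_isCohTrivialAt
    (hdef : ∀ τ' : L →+* ℂ, InfinitePlace.mk τ' ≠ InfinitePlace.mk ι → (H.map τ').PosDef) (h2 : 2 ≤ Module.finrank ℚ ↥(maximalRealSubfield L))
    (P : DiscreteAutomorphicRep (adelicGroupData (↥(maximalRealSubfield L)) L (IsCMField.complexConj L) 3 H) μ)
    (hP : P.IsHolCotangentAt (cmArchSection L ι H T hT) (cmCompactFactor L ι H T hT) ∨
      P.IsAntiholCotangentAt (cmArchSection L ι H T hT) (cmCompactFactor L ι H T hT))
    (hM : IsGKModule (uFormGroup (Fin 2) (Fin 1)) σK σ𝔤) (hirr : IsIrreducibleGK σK σ𝔤)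
    (T₁ : P.archModuleCM ι T hT →ₗ[ℂ] M)
    (hT₁K : ∀ (k : (uFormGroup (Fin 2) (Fin 1)).maximalCompact) (w : P.archModuleCM ι T hT), T₁ (P.archRepKCM ι T hT k w) = σK k (T₁ w))
    (hT₁𝔤 : ∀ (X : (uFormGroup (Fin 2) (Fin 1)).lie) (w : P.archModuleCM ι T hT), T₁ (P.archRepLieCM ι T hT X w) = σ𝔤 X (T₁ w))
    (hT₁ : T₁ ≠ 0) {ξ : OneDimAutRepH L} {t : ℤ} (hct : ξ.IsCohTrivialAt t ι) {a b c : ℤ}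
    (habc : ArchSignRecipe.rogTriple (ξ.pη ι) (ξ.qψ ι) t = (a, b, c)) :
    (∀ v : M, upqCasimirOp σ𝔤 v = ((a ^ 2 + b ^ 2 + c ^ 2 - 2 : ℤ) : ℂ) • v) ∧
      ∃ s : ℤ, (s = a + b + c ∨ s = -(a + b + c)) ∧
        ∀ Z : (uFormGroup (Fin 2) (Fin 1)).lie,
          (Z : Matrix (Fin 2 ⊕ Fin 1) (Fin 2 ⊕ Fin 1) ℂ) = Complex.I • (1 : Matrix (Fin 2 ⊕ Fin 1) (Fin 2 ⊕ Fin 1) ℂ) →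
            ∀ v : M, σ𝔤 Z v = ((s : ℂ) * Complex.I) • v := by
  have h101 : ArchSignRecipe.rogTriple (ξ.pη ι) (ξ.qψ ι) t = (1, 0, -1) := hct
  rw [habc, Prod.mk.injEq, Prod.mk.injEq] at h101
  obtain ⟨rfl, rfl, rfl⟩ := h101
  -- the token `M` is cohomological («Tok»), so the Casimir and the centre kill nothing only if they act by zero («Wχ» W4)
  obtain ⟨δ, -, hne⟩ := exists_upqTypeClasses_ne_bot_of_token_cpt L ι H T hT μ hdef h2 P hP hM hirr T₁ hT₁K hT₁𝔤 hT₁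
  obtain ⟨hC0, hZ0⟩ := wχ_casimir_and_central_eq_zero_of_typeClasses_ne_bot hM hirr hne
  have e1 : ((1 ^ 2 + 0 ^ 2 + (-1) ^ 2 - 2 : ℤ) : ℂ) = 0 := by norm_num
  refine ⟨fun v => by rw [e1, zero_smul, hC0 v], 0, Or.inl (by norm_num), fun Z hZ v => ?_⟩
  rw [hZ0 Z Complex.I hZ v, Int.cast_zero, zero_mul, zero_smul]

end Pointwise

/-- **The χ-currency Wigner step** (Theorems-side twin of the leaf's bridge): if on a `(𝔤,K)`-module `M` of `U(2,1)` the Casimir acts by `κ = a²+b²+c²−2` and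
`i·1` by `±i(a+b+c)`, `(a,b,c) = rogTriple (ξ.pη ι) (ξ.qψ ι) t`, and some `H^n_δ(𝔤,K;M) ≠ ⊥`, then `ξ.IsCohTrivialAt t ι` (★ p849137: a non-zero Casimir or
central scalar kills `H^n_δ`; ★ p849139 `aχ_isCohTrivial_of_chi`). [cite: BorelWallach2000, II Cor. 3.3; I §5.3] [cite: Rogawski1990, §12.3 p. 178; Prop. 15.2.1 (b) p. 249] -/
theorem isCohTrivialAt_of_globalChi {L : Type} [Field L] [NumberField L] [IsCMField L] {ξ : OneDimAutRepH L} {ι : L →+* ℂ} {t : ℤ}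
    {M : Type} [AddCommGroup M] [Module ℂ M]
    {σK : Representation ℂ (uFormGroup (Fin 2) (Fin 1)).maximalCompact M} {σ𝔤 : (uFormGroup (Fin 2) (Fin 1)).lie →ₗ⁅ℝ⁆ Module.End ℂ M}
    (hM : IsGKModule (uFormGroup (Fin 2) (Fin 1)) σK σ𝔤)
    (h : (∀ v : M, upqCasimirOp σ𝔤 v =
        (((ArchSignRecipe.rogTriple (ξ.pη ι) (ξ.qψ ι) t).1 ^ 2 + (ArchSignRecipe.rogTriple (ξ.pη ι) (ξ.qψ ι) t).2.1 ^ 2 +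
            (ArchSignRecipe.rogTriple (ξ.pη ι) (ξ.qψ ι) t).2.2 ^ 2 - 2 : ℤ) : ℂ) • v) ∧
      ∃ s : ℤ, (s = (ArchSignRecipe.rogTriple (ξ.pη ι) (ξ.qψ ι) t).1 + (ArchSignRecipe.rogTriple (ξ.pη ι) (ξ.qψ ι) t).2.1 +
            (ArchSignRecipe.rogTriple (ξ.pη ι) (ξ.qψ ι) t).2.2 ∨
          s = -((ArchSignRecipe.rogTriple (ξ.pη ι) (ξ.qψ ι) t).1 + (ArchSignRecipe.rogTriple (ξ.pη ι) (ξ.qψ ι) t).2.1 +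
            (ArchSignRecipe.rogTriple (ξ.pη ι) (ξ.qψ ι) t).2.2)) ∧
        ∀ Z : (uFormGroup (Fin 2) (Fin 1)).lie,
          (Z : Matrix (Fin 2 ⊕ Fin 1) (Fin 2 ⊕ Fin 1) ℂ) = Complex.I • (1 : Matrix (Fin 2 ⊕ Fin 1) (Fin 2 ⊕ Fin 1) ℂ) →
            ∀ v : M, σ𝔤 Z v = ((s : ℂ) * Complex.I) • v)
    {n : ℕ} {δ : ℤ} (hne : upqTypeClasses σK σ𝔤 hM.ad_compat n δ ≠ ⊥) :
    ξ.IsCohTrivialAt t ι := by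
  obtain ⟨hC, s, hs₁, hs⟩ := h
  have hκ : rogCasimirScalar (ξ.pη ι) (ξ.qψ ι) t = 0 := by
    by_contra hκ0
    have hc : ((rogCasimirScalar (ξ.pη ι) (ξ.qψ ι) t : ℤ) : ℂ) ≠ 0 := by exact_mod_cast hκ0
    exact hne (upqTypeClasses_eq_bot_of_upqCasimirOp_eq_smul σK σ𝔤 hM.ad_compat hc hC n δ)
  have hsI : ((s : ℂ) * Complex.I) = 0 := by
    by_contra hs0
    exact hne (upqTypeClasses_eq_bot_of_center_eq_smul σK σ𝔤 hM.ad_compat (Z := ⟨Complex.I • 1, upq_I_smul_one_mem_lie⟩) (a := Complex.I) rfl hs0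
      (hs ⟨Complex.I • 1, upq_I_smul_one_mem_lie⟩ rfl) n δ)
  have hs0 : s = 0 := by exact_mod_cast (mul_eq_zero.1 hsI).resolve_right Complex.I_ne_zero
  have he : rogCentralSum (ξ.pη ι) (ξ.qψ ι) t = 0 := by
    unfold rogCentralSum
    rcases hs₁ with h | h <;> omega
  exact aχ_isCohTrivial_of_chi hκ he

/-! ## §2 ED. 1's organ PIN-ι ⟺ ED. 2's organ GLOBAL-ι^χ (texts token for token, modulo ★) -/

/-- **PIN-ι ⟹ GLOBAL-ι^χ** (ED. 1 organ ⟹ ED. 2 organ): the cotangent `P` carries a COHOMOLOGICAL token `(M₀, δ₀)` (★ K4 `exists_cohToken_of_isHolOrAntihol_cpt`),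
at which PIN-ι yields `ξ.IsCohTrivialAt (tOfArchType k₀ ι) ι`; then §1 at the organ's ARBITRARY token `M`.  In print: `P_ι ∈ Π(φ(1,0,−1))`, infinitesimal character
of `𝟙`. [cite: Rogawski1990, §12.3 pp. 174–178 (Prop. 12.3.3); Prop. 15.2.1 (b) (p. 249); Thm. 13.3.5; §14.6 Thm. 14.6.4] [cite: BorelWallach2000, II Cor. 3.3; I §5.3] [cite: KnappVogan1995, Prop. 4.120; Prop. 11.43] -/
theorem globalIotaChi_of_pinIota
    (hIota :
      ∀ (L : Type) [Field L] [NumberField L] [IsCMField L] (ι : L →+* ℂ) (H : Matrix (Fin 3) (Fin 3) L) (T : GL (Fin 3) ℂ)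
        (hT : (T : Matrix (Fin 3) (Fin 3) ℂ)ᴴ * H.map ι * (T : Matrix (Fin 3) (Fin 3) ℂ) = Literature.Geometry.ComplexHyperbolic.BallModel.J),
        (∀ τ' : L →+* ℂ, InfinitePlace.mk τ' ≠ InfinitePlace.mk ι → (H.map τ').PosDef) →
        2 ≤ Module.finrank ℚ ↥(maximalRealSubfield L) →
        ∀ (μ : Measure (adelicGroupData (↥(maximalRealSubfield L)) L (IsCMField.complexConj L) 3 H).automorphicQuotient)
          [(adelicGroupData (↥(maximalRealSubfield L)) L (IsCMField.complexConj L) 3 H).IsAutomorphicMeasure μ]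
          (μω : HeckeCharacter L) (hμu : μω.IsUnitary),
          (∀ x : Literature.NumberTheory.GaloisRepresentations.ideleGroup ↥(maximalRealSubfield L),
            μω (AdeleRing.ideleBaseChange (↥(maximalRealSubfield L)) L x) = quadraticHeckeCharCM L x) →
        ∀ (P : DiscreteAutomorphicRep (adelicGroupData (↥(maximalRealSubfield L)) L (IsCMField.complexConj L) 3 H) μ),
          (P.IsHolCotangentAt (cmArchSection L ι H T hT) (cmCompactFactor L ι H T hT) ∨
            P.IsAntiholCotangentAt (cmArchSection L ι H T hT) (cmCompactFactor L ι H T hT)) →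
          ∀ (M : Type) [AddCommGroup M] [Module ℂ M]
            (σK : Representation ℂ (uFormGroup (Fin 2) (Fin 1)).maximalCompact M) (σ𝔤 : (uFormGroup (Fin 2) (Fin 1)).lie →ₗ⁅ℝ⁆ Module.End ℂ M)
            (hM : IsGKModule (uFormGroup (Fin 2) (Fin 1)) σK σ𝔤), IsIrreducibleGK σK σ𝔤 →
            (∃ T₁ : P.archModuleCM ι T hT →ₗ[ℂ] M,
              (∀ (k : (uFormGroup (Fin 2) (Fin 1)).maximalCompact) (w : P.archModuleCM ι T hT), T₁ (P.archRepKCM ι T hT k w) = σK k (T₁ w)) ∧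
                (∀ (X : (uFormGroup (Fin 2) (Fin 1)).lie) (w : P.archModuleCM ι T hT), T₁ (P.archRepLieCM ι T hT X w) = σ𝔤 X (T₁ w)) ∧ T₁ ≠ 0) →
            ∀ δ : ℤ, (δ = 1 ∨ δ = -1) → upqTypeClasses σK σ𝔤 hM.ad_compat 1 δ ≠ ⊥ →
              ∀ ξ : OneDimAutRepH L,
                MemXiFamily P (transpose_map_cmConjRingHom_eq_of_frame L ι H T hT) (isUnit_det_of_frame L ι H T hT) μω hμu ξ →
                  ξ.IsCohTrivialAt (ArchSignRecipe.tOfArchType (archTypeOfRecord μω) ι) ι) :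
    ∀ (L : Type) [Field L] [NumberField L] [IsCMField L] (ι : L →+* ℂ) (H : Matrix (Fin 3) (Fin 3) L) (T : GL (Fin 3) ℂ)
      (hT : (T : Matrix (Fin 3) (Fin 3) ℂ)ᴴ * H.map ι * (T : Matrix (Fin 3) (Fin 3) ℂ) = Literature.Geometry.ComplexHyperbolic.BallModel.J),
      (∀ τ' : L →+* ℂ, InfinitePlace.mk τ' ≠ InfinitePlace.mk ι → (H.map τ').PosDef) →
      2 ≤ Module.finrank ℚ ↥(maximalRealSubfield L) →
      ∀ (μ : Measure (adelicGroupData (↥(maximalRealSubfield L)) L (IsCMField.complexConj L) 3 H).automorphicQuotient)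
        [(adelicGroupData (↥(maximalRealSubfield L)) L (IsCMField.complexConj L) 3 H).IsAutomorphicMeasure μ]
        (μω : HeckeCharacter L) (hμu : μω.IsUnitary),
        (∀ x : Literature.NumberTheory.GaloisRepresentations.ideleGroup ↥(maximalRealSubfield L),
          μω (AdeleRing.ideleBaseChange (↥(maximalRealSubfield L)) L x) = quadraticHeckeCharCM L x) →
      ∀ (P : DiscreteAutomorphicRep (adelicGroupData (↥(maximalRealSubfield L)) L (IsCMField.complexConj L) 3 H) μ),
        (P.IsHolCotangentAt (cmArchSection L ι H T hT) (cmCompactFactor L ι H T hT) ∨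
          P.IsAntiholCotangentAt (cmArchSection L ι H T hT) (cmCompactFactor L ι H T hT)) →
        ∀ (M : Type) [AddCommGroup M] [Module ℂ M]
          (σK : Representation ℂ (uFormGroup (Fin 2) (Fin 1)).maximalCompact M) (σ𝔤 : (uFormGroup (Fin 2) (Fin 1)).lie →ₗ⁅ℝ⁆ Module.End ℂ M)
          (hM : IsGKModule (uFormGroup (Fin 2) (Fin 1)) σK σ𝔤), IsIrreducibleGK σK σ𝔤 →
          (∃ T₁ : P.archModuleCM ι T hT →ₗ[ℂ] M,
            (∀ (k : (uFormGroup (Fin 2) (Fin 1)).maximalCompact) (w : P.archModuleCM ι T hT), T₁ (P.archRepKCM ι T hT k w) = σK k (T₁ w)) ∧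
              (∀ (X : (uFormGroup (Fin 2) (Fin 1)).lie) (w : P.archModuleCM ι T hT), T₁ (P.archRepLieCM ι T hT X w) = σ𝔤 X (T₁ w)) ∧ T₁ ≠ 0) →
          ∀ ξ : OneDimAutRepH L,
            MemXiFamily P (transpose_map_cmConjRingHom_eq_of_frame L ι H T hT) (isUnit_det_of_frame L ι H T hT) μω hμu ξ →
              ∀ a b c : ℤ, ArchSignRecipe.rogTriple (ξ.pη ι) (ξ.qψ ι) (ArchSignRecipe.tOfArchType (archTypeOfRecord μω) ι) = (a, b, c) →
                (∀ v : M, upqCasimirOp σ𝔤 v = ((a ^ 2 + b ^ 2 + c ^ 2 - 2 : ℤ) : ℂ) • v) ∧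
                ∃ s : ℤ, (s = a + b + c ∨ s = -(a + b + c)) ∧
                  ∀ Z : (uFormGroup (Fin 2) (Fin 1)).lie,
                    (Z : Matrix (Fin 2 ⊕ Fin 1) (Fin 2 ⊕ Fin 1) ℂ) = Complex.I • (1 : Matrix (Fin 2 ⊕ Fin 1) (Fin 2 ⊕ Fin 1) ℂ) →
                      ∀ v : M, σ𝔤 Z v = ((s : ℂ) * Complex.I) • v := by
  intro L _ _ _ ι H T hT hdef h2 μ _ μω hμu hμω P hP M _ _ σK σ𝔤 hM hirr htok ξ hmem a b c habc
  -- a COHOMOLOGICAL token of the cotangent `P` (★ K4), where PIN-ι pins `ξ`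
  obtain ⟨M₀, _, _, σK₀, σ𝔤₀, hM₀, δ₀, hδ₀, hirr₀, htok₀, hne₀⟩ := exists_cohToken_of_isHolOrAntihol_cpt L ι H T hT μ hdef h2 P hP
  have hct := hIota L ι H T hT hdef h2 μ μω hμu hμω P hP M₀ σK₀ σ𝔤₀ hM₀ hirr₀ htok₀ δ₀ hδ₀ hne₀ ξ hmem
  obtain ⟨T₁, hT₁K, hT₁𝔤, hT₁⟩ := htok
  exact globalChi_of_isCohTrivialAt L ι H T hT μ hdef h2 P hP hM hirr T₁ hT₁K hT₁𝔤 hT₁ hct habc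

/-- **GLOBAL-ι^χ ⟹ PIN-ι** (ED. 2 organ ⟹ ED. 1 organ; the `ι`-branch of the ED. 2 head, organ-to-organ): GLOBAL-ι^χ at PIN-ι's own token `M` (which carries
`H¹_δ ≠ ⊥`), then `isCohTrivialAt_of_globalChi`. [cite: Rogawski1990, Prop. 15.2.1 (b) (p. 249); §12.3 p. 178] [cite: BorelWallach2000, II Cor. 3.3; I §5.3] -/
theorem pinIota_of_globalIotaChi
    (hChi :
      ∀ (L : Type) [Field L] [NumberField L] [IsCMField L] (ι : L →+* ℂ) (H : Matrix (Fin 3) (Fin 3) L) (T : GL (Fin 3) ℂ)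
        (hT : (T : Matrix (Fin 3) (Fin 3) ℂ)ᴴ * H.map ι * (T : Matrix (Fin 3) (Fin 3) ℂ) = Literature.Geometry.ComplexHyperbolic.BallModel.J),
        (∀ τ' : L →+* ℂ, InfinitePlace.mk τ' ≠ InfinitePlace.mk ι → (H.map τ').PosDef) →
        2 ≤ Module.finrank ℚ ↥(maximalRealSubfield L) →
        ∀ (μ : Measure (adelicGroupData (↥(maximalRealSubfield L)) L (IsCMField.complexConj L) 3 H).automorphicQuotient)
          [(adelicGroupData (↥(maximalRealSubfield L)) L (IsCMField.complexConj L) 3 H).IsAutomorphicMeasure μ]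
          (μω : HeckeCharacter L) (hμu : μω.IsUnitary),
          (∀ x : Literature.NumberTheory.GaloisRepresentations.ideleGroup ↥(maximalRealSubfield L),
            μω (AdeleRing.ideleBaseChange (↥(maximalRealSubfield L)) L x) = quadraticHeckeCharCM L x) →
        ∀ (P : DiscreteAutomorphicRep (adelicGroupData (↥(maximalRealSubfield L)) L (IsCMField.complexConj L) 3 H) μ),
          (P.IsHolCotangentAt (cmArchSection L ι H T hT) (cmCompactFactor L ι H T hT) ∨
            P.IsAntiholCotangentAt (cmArchSection L ι H T hT) (cmCompactFactor L ι H T hT)) →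
          ∀ (M : Type) [AddCommGroup M] [Module ℂ M]
            (σK : Representation ℂ (uFormGroup (Fin 2) (Fin 1)).maximalCompact M) (σ𝔤 : (uFormGroup (Fin 2) (Fin 1)).lie →ₗ⁅ℝ⁆ Module.End ℂ M)
            (hM : IsGKModule (uFormGroup (Fin 2) (Fin 1)) σK σ𝔤), IsIrreducibleGK σK σ𝔤 →
            (∃ T₁ : P.archModuleCM ι T hT →ₗ[ℂ] M,
              (∀ (k : (uFormGroup (Fin 2) (Fin 1)).maximalCompact) (w : P.archModuleCM ι T hT), T₁ (P.archRepKCM ι T hT k w) = σK k (T₁ w)) ∧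
                (∀ (X : (uFormGroup (Fin 2) (Fin 1)).lie) (w : P.archModuleCM ι T hT), T₁ (P.archRepLieCM ι T hT X w) = σ𝔤 X (T₁ w)) ∧ T₁ ≠ 0) →
            ∀ ξ : OneDimAutRepH L,
              MemXiFamily P (transpose_map_cmConjRingHom_eq_of_frame L ι H T hT) (isUnit_det_of_frame L ι H T hT) μω hμu ξ →
                ∀ a b c : ℤ, ArchSignRecipe.rogTriple (ξ.pη ι) (ξ.qψ ι) (ArchSignRecipe.tOfArchType (archTypeOfRecord μω) ι) = (a, b, c) →
                  (∀ v : M, upqCasimirOp σ𝔤 v = ((a ^ 2 + b ^ 2 + c ^ 2 - 2 : ℤ) : ℂ) • v) ∧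
                  ∃ s : ℤ, (s = a + b + c ∨ s = -(a + b + c)) ∧
                    ∀ Z : (uFormGroup (Fin 2) (Fin 1)).lie,
                      (Z : Matrix (Fin 2 ⊕ Fin 1) (Fin 2 ⊕ Fin 1) ℂ) = Complex.I • (1 : Matrix (Fin 2 ⊕ Fin 1) (Fin 2 ⊕ Fin 1) ℂ) →
                        ∀ v : M, σ𝔤 Z v = ((s : ℂ) * Complex.I) • v) :
    ∀ (L : Type) [Field L] [NumberField L] [IsCMField L] (ι : L →+* ℂ) (H : Matrix (Fin 3) (Fin 3) L) (T : GL (Fin 3) ℂ)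
      (hT : (T : Matrix (Fin 3) (Fin 3) ℂ)ᴴ * H.map ι * (T : Matrix (Fin 3) (Fin 3) ℂ) = Literature.Geometry.ComplexHyperbolic.BallModel.J),
      (∀ τ' : L →+* ℂ, InfinitePlace.mk τ' ≠ InfinitePlace.mk ι → (H.map τ').PosDef) →
      2 ≤ Module.finrank ℚ ↥(maximalRealSubfield L) →
      ∀ (μ : Measure (adelicGroupData (↥(maximalRealSubfield L)) L (IsCMField.complexConj L) 3 H).automorphicQuotient)
        [(adelicGroupData (↥(maximalRealSubfield L)) L (IsCMField.complexConj L) 3 H).IsAutomorphicMeasure μ]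
        (μω : HeckeCharacter L) (hμu : μω.IsUnitary),
        (∀ x : Literature.NumberTheory.GaloisRepresentations.ideleGroup ↥(maximalRealSubfield L),
          μω (AdeleRing.ideleBaseChange (↥(maximalRealSubfield L)) L x) = quadraticHeckeCharCM L x) →
      ∀ (P : DiscreteAutomorphicRep (adelicGroupData (↥(maximalRealSubfield L)) L (IsCMField.complexConj L) 3 H) μ),
        (P.IsHolCotangentAt (cmArchSection L ι H T hT) (cmCompactFactor L ι H T hT) ∨
          P.IsAntiholCotangentAt (cmArchSection L ι H T hT) (cmCompactFactor L ι H T hT)) →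
        ∀ (M : Type) [AddCommGroup M] [Module ℂ M]
          (σK : Representation ℂ (uFormGroup (Fin 2) (Fin 1)).maximalCompact M) (σ𝔤 : (uFormGroup (Fin 2) (Fin 1)).lie →ₗ⁅ℝ⁆ Module.End ℂ M)
          (hM : IsGKModule (uFormGroup (Fin 2) (Fin 1)) σK σ𝔤), IsIrreducibleGK σK σ𝔤 →
          (∃ T₁ : P.archModuleCM ι T hT →ₗ[ℂ] M,
            (∀ (k : (uFormGroup (Fin 2) (Fin 1)).maximalCompact) (w : P.archModuleCM ι T hT), T₁ (P.archRepKCM ι T hT k w) = σK k (T₁ w)) ∧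
              (∀ (X : (uFormGroup (Fin 2) (Fin 1)).lie) (w : P.archModuleCM ι T hT), T₁ (P.archRepLieCM ι T hT X w) = σ𝔤 X (T₁ w)) ∧ T₁ ≠ 0) →
          ∀ δ : ℤ, (δ = 1 ∨ δ = -1) → upqTypeClasses σK σ𝔤 hM.ad_compat 1 δ ≠ ⊥ →
            ∀ ξ : OneDimAutRepH L,
              MemXiFamily P (transpose_map_cmConjRingHom_eq_of_frame L ι H T hT) (isUnit_det_of_frame L ι H T hT) μω hμu ξ →
                ξ.IsCohTrivialAt (ArchSignRecipe.tOfArchType (archTypeOfRecord μω) ι) ι := by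
  intro L _ _ _ ι H T hT hdef h2 μ _ μω hμu hμω P hP M _ _ σK σ𝔤 hM hirr htok δ hδ hne ξ hmem
  exact isCohTrivialAt_of_globalChi hM (hChi L ι H T hT hdef h2 μ μω hμu hμω P hP M σK σ𝔤 hM hirr htok ξ hmem _ _ _ rfl) hne

/-! ## §3 S2♯ ⟹ GLOBAL-ι^χ (desk (c6): the H¹-free organ is not stronger than print-plus-★) -/

/-- **S2♯ ⟹ ORGAN GLOBAL-ι^χ**: ★ ED. 1 leg `s2PinIota_of_S2sharp` (S2♯'s `K_c` clause discharged for the cotangent `P` by ★ p819716, `ξ = ξ₀` by U♭-cot ★ p847744,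
the pin read at `k₀` ★ `hasUnitaryArchType_archTypeOfRecord`) followed by §2 `globalIotaChi_of_pinIota`.
[cite: Rogawski1990, Thm. 13.3.5 and Thm. 13.3.6 (c) (p. 202); §14.6 Thm. 14.6.4 (p. 243); §12.2 p. 174; §12.3 pp. 174–178 (Prop. 12.3.3 p. 178); §13.1 p. 199; Prop. 15.2.1 (b) (p. 249)]
[cite: KnappVogan1995, Prop. 4.120; Prop. 11.43] [cite: BorelWallach2000, II §1.3; II Cor. 3.3; I §5.3] [cite: Liu2021, Remark 4.2] -/
theorem s2GlobalIotaChi_of_S2sharp (h : Literature.NumberTheory.Rogawski1990.cohDiscrete_memXiFamily_archPinned) :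
    ∀ (L : Type) [Field L] [NumberField L] [IsCMField L] (ι : L →+* ℂ) (H : Matrix (Fin 3) (Fin 3) L) (T : GL (Fin 3) ℂ)
      (hT : (T : Matrix (Fin 3) (Fin 3) ℂ)ᴴ * H.map ι * (T : Matrix (Fin 3) (Fin 3) ℂ) = Literature.Geometry.ComplexHyperbolic.BallModel.J),
      (∀ τ' : L →+* ℂ, InfinitePlace.mk τ' ≠ InfinitePlace.mk ι → (H.map τ').PosDef) →
      2 ≤ Module.finrank ℚ ↥(maximalRealSubfield L) →
      ∀ (μ : Measure (adelicGroupData (↥(maximalRealSubfield L)) L (IsCMField.complexConj L) 3 H).automorphicQuotient)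
        [(adelicGroupData (↥(maximalRealSubfield L)) L (IsCMField.complexConj L) 3 H).IsAutomorphicMeasure μ]
        (μω : HeckeCharacter L) (hμu : μω.IsUnitary),
        (∀ x : Literature.NumberTheory.GaloisRepresentations.ideleGroup ↥(maximalRealSubfield L),
          μω (AdeleRing.ideleBaseChange (↥(maximalRealSubfield L)) L x) = quadraticHeckeCharCM L x) →
      ∀ (P : DiscreteAutomorphicRep (adelicGroupData (↥(maximalRealSubfield L)) L (IsCMField.complexConj L) 3 H) μ),
        (P.IsHolCotangentAt (cmArchSection L ι H T hT) (cmCompactFactor L ι H T hT) ∨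
          P.IsAntiholCotangentAt (cmArchSection L ι H T hT) (cmCompactFactor L ι H T hT)) →
        ∀ (M : Type) [AddCommGroup M] [Module ℂ M]
          (σK : Representation ℂ (uFormGroup (Fin 2) (Fin 1)).maximalCompact M) (σ𝔤 : (uFormGroup (Fin 2) (Fin 1)).lie →ₗ⁅ℝ⁆ Module.End ℂ M)
          (hM : IsGKModule (uFormGroup (Fin 2) (Fin 1)) σK σ𝔤), IsIrreducibleGK σK σ𝔤 →
          (∃ T₁ : P.archModuleCM ι T hT →ₗ[ℂ] M,
            (∀ (k : (uFormGroup (Fin 2) (Fin 1)).maximalCompact) (w : P.archModuleCM ι T hT), T₁ (P.archRepKCM ι T hT k w) = σK k (T₁ w)) ∧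
              (∀ (X : (uFormGroup (Fin 2) (Fin 1)).lie) (w : P.archModuleCM ι T hT), T₁ (P.archRepLieCM ι T hT X w) = σ𝔤 X (T₁ w)) ∧ T₁ ≠ 0) →
          ∀ ξ : OneDimAutRepH L,
            MemXiFamily P (transpose_map_cmConjRingHom_eq_of_frame L ι H T hT) (isUnit_det_of_frame L ι H T hT) μω hμu ξ →
              ∀ a b c : ℤ, ArchSignRecipe.rogTriple (ξ.pη ι) (ξ.qψ ι) (ArchSignRecipe.tOfArchType (archTypeOfRecord μω) ι) = (a, b, c) →
                (∀ v : M, upqCasimirOp σ𝔤 v = ((a ^ 2 + b ^ 2 + c ^ 2 - 2 : ℤ) : ℂ) • v) ∧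
                ∃ s : ℤ, (s = a + b + c ∨ s = -(a + b + c)) ∧
                  ∀ Z : (uFormGroup (Fin 2) (Fin 1)).lie,
                    (Z : Matrix (Fin 2 ⊕ Fin 1) (Fin 2 ⊕ Fin 1) ℂ) = Complex.I • (1 : Matrix (Fin 2 ⊕ Fin 1) (Fin 2 ⊕ Fin 1) ℂ) →
                      ∀ v : M, σ𝔤 Z v = ((s : ℂ) * Complex.I) • v :=
  globalIotaChi_of_pinIota (s2PinIota_of_S2sharp h)

/-! ## §4 THE CERTIFICATE: S2♯ ↔ FIN ∧ GLOBAL-ι^χ ∧ PIN-τ -/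

/-- **THE EQUIVALENCE CERTIFICATE for ED. 2 «χ»** — the print letter #80 S2♯ ★ `cohDiscrete_memXiFamily_archPinned` is EQUIVALENT to the conjunction of the ED. 2
organs FIN ∧ GLOBAL-ι^χ ∧ PIN-τ (texts token for token), modulo the in-house ★ facts named in the header: ⟹ by ★ `s2Fin_of_S2sharp`, §3, ★ `s2PinCompact_of_S2sharp`;
⟸ by §2 `pinIota_of_globalIotaChi` and the ★ ED. 1 head `s2sharp_of_organs` (`.2 ⟨hFin, hChi, hCpt⟩` = the hypothesis-free carrier).  Books: #80 ≡ FIN + GLOBAL-ι^χ + PIN-τ.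
[cite: Rogawski1990, §14.6 Thm. 14.6.4 (p. 243) and pp. 242–243; Prop. 15.2.1 (a)(b) (p. 249); §12.2 p. 174; §12.3 pp. 174–178; Thm. 13.3.5 and Thm. 13.3.6 (c) (p. 202); §13.1 p. 199; §15.3 ¶1]
[cite: BorelWallach2000, II Cor. 3.3; I §5.3; VI Thm. 4.11] [cite: KnappVogan1995, Prop. 4.120; Prop. 11.43] [cite: Liu2021, Remark 4.2] -/
theorem s2sharp_iff_organsChi :
    Literature.NumberTheory.Rogawski1990.cohDiscrete_memXiFamily_archPinned ↔
      (∀ (L : Type) [Field L] [NumberField L] [IsCMField L] (ι : L →+* ℂ) (H : Matrix (Fin 3) (Fin 3) L) (T : GL (Fin 3) ℂ)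
        (hT : (T : Matrix (Fin 3) (Fin 3) ℂ)ᴴ * H.map ι * (T : Matrix (Fin 3) (Fin 3) ℂ) = Literature.Geometry.ComplexHyperbolic.BallModel.J),
        (∀ τ' : L →+* ℂ, InfinitePlace.mk τ' ≠ InfinitePlace.mk ι → (H.map τ').PosDef) →
        2 ≤ Module.finrank ℚ ↥(maximalRealSubfield L) →
        ∀ (μ : Measure (adelicGroupData (↥(maximalRealSubfield L)) L (IsCMField.complexConj L) 3 H).automorphicQuotient)
          [(adelicGroupData (↥(maximalRealSubfield L)) L (IsCMField.complexConj L) 3 H).IsAutomorphicMeasure μ]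
          (μω : HeckeCharacter L) (hμu : μω.IsUnitary),
          (∀ x : Literature.NumberTheory.GaloisRepresentations.ideleGroup ↥(maximalRealSubfield L),
            μω (AdeleRing.ideleBaseChange (↥(maximalRealSubfield L)) L x) = quadraticHeckeCharCM L x) →
        ∀ (P : DiscreteAutomorphicRep (adelicGroupData (↥(maximalRealSubfield L)) L (IsCMField.complexConj L) 3 H) μ),
          (P.IsHolCotangentAt (cmArchSection L ι H T hT) (cmCompactFactor L ι H T hT) ∨
            P.IsAntiholCotangentAt (cmArchSection L ι H T hT) (cmCompactFactor L ι H T hT)) →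
          (∀ k : (adelicGroupData (↥(maximalRealSubfield L)) L (IsCMField.complexConj L) 3 H).Adelic, k ∈ cmCompactFactor L ι H T hT →
            ∀ v : P.space.toSubmodule, (adelicGroupData (↥(maximalRealSubfield L)) L (IsCMField.complexConj L) 3 H).rightRegular μ k
              (v : (adelicGroupData (↥(maximalRealSubfield L)) L (IsCMField.complexConj L) 3 H).L2 μ) = v) →
          ∀ (M : Type) [AddCommGroup M] [Module ℂ M]
            (σK : Representation ℂ (uFormGroup (Fin 2) (Fin 1)).maximalCompact M) (σ𝔤 : (uFormGroup (Fin 2) (Fin 1)).lie →ₗ⁅ℝ⁆ Module.End ℂ M)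
            (hM : IsGKModule (uFormGroup (Fin 2) (Fin 1)) σK σ𝔤), IsIrreducibleGK σK σ𝔤 →
            (∃ T₁ : P.archModuleCM ι T hT →ₗ[ℂ] M,
              (∀ (k : (uFormGroup (Fin 2) (Fin 1)).maximalCompact) (w : P.archModuleCM ι T hT), T₁ (P.archRepKCM ι T hT k w) = σK k (T₁ w)) ∧
                (∀ (X : (uFormGroup (Fin 2) (Fin 1)).lie) (w : P.archModuleCM ι T hT), T₁ (P.archRepLieCM ι T hT X w) = σ𝔤 X (T₁ w)) ∧ T₁ ≠ 0) →
            ∀ δ : ℤ, (δ = 1 ∨ δ = -1) → upqTypeClasses σK σ𝔤 hM.ad_compat 1 δ ≠ ⊥ →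
              ∃ ξ : OneDimAutRepH L,
                MemXiFamily P (transpose_map_cmConjRingHom_eq_of_frame L ι H T hT) (isUnit_det_of_frame L ι H T hT) μω hμu ξ) ∧
      (∀ (L : Type) [Field L] [NumberField L] [IsCMField L] (ι : L →+* ℂ) (H : Matrix (Fin 3) (Fin 3) L) (T : GL (Fin 3) ℂ)
        (hT : (T : Matrix (Fin 3) (Fin 3) ℂ)ᴴ * H.map ι * (T : Matrix (Fin 3) (Fin 3) ℂ) = Literature.Geometry.ComplexHyperbolic.BallModel.J),
        (∀ τ' : L →+* ℂ, InfinitePlace.mk τ' ≠ InfinitePlace.mk ι → (H.map τ').PosDef) →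
        2 ≤ Module.finrank ℚ ↥(maximalRealSubfield L) →
        ∀ (μ : Measure (adelicGroupData (↥(maximalRealSubfield L)) L (IsCMField.complexConj L) 3 H).automorphicQuotient)
          [(adelicGroupData (↥(maximalRealSubfield L)) L (IsCMField.complexConj L) 3 H).IsAutomorphicMeasure μ]
          (μω : HeckeCharacter L) (hμu : μω.IsUnitary),
          (∀ x : Literature.NumberTheory.GaloisRepresentations.ideleGroup ↥(maximalRealSubfield L),
            μω (AdeleRing.ideleBaseChange (↥(maximalRealSubfield L)) L x) = quadraticHeckeCharCM L x) →
        ∀ (P : DiscreteAutomorphicRep (adelicGroupData (↥(maximalRealSubfield L)) L (IsCMField.complexConj L) 3 H) μ),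
          (P.IsHolCotangentAt (cmArchSection L ι H T hT) (cmCompactFactor L ι H T hT) ∨
            P.IsAntiholCotangentAt (cmArchSection L ι H T hT) (cmCompactFactor L ι H T hT)) →
          ∀ (M : Type) [AddCommGroup M] [Module ℂ M]
            (σK : Representation ℂ (uFormGroup (Fin 2) (Fin 1)).maximalCompact M) (σ𝔤 : (uFormGroup (Fin 2) (Fin 1)).lie →ₗ⁅ℝ⁆ Module.End ℂ M)
            (hM : IsGKModule (uFormGroup (Fin 2) (Fin 1)) σK σ𝔤), IsIrreducibleGK σK σ𝔤 →
            (∃ T₁ : P.archModuleCM ι T hT →ₗ[ℂ] M,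
              (∀ (k : (uFormGroup (Fin 2) (Fin 1)).maximalCompact) (w : P.archModuleCM ι T hT), T₁ (P.archRepKCM ι T hT k w) = σK k (T₁ w)) ∧
                (∀ (X : (uFormGroup (Fin 2) (Fin 1)).lie) (w : P.archModuleCM ι T hT), T₁ (P.archRepLieCM ι T hT X w) = σ𝔤 X (T₁ w)) ∧ T₁ ≠ 0) →
            ∀ ξ : OneDimAutRepH L,
              MemXiFamily P (transpose_map_cmConjRingHom_eq_of_frame L ι H T hT) (isUnit_det_of_frame L ι H T hT) μω hμu ξ →
                ∀ a b c : ℤ, ArchSignRecipe.rogTriple (ξ.pη ι) (ξ.qψ ι) (ArchSignRecipe.tOfArchType (archTypeOfRecord μω) ι) = (a, b, c) →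
                  (∀ v : M, upqCasimirOp σ𝔤 v = ((a ^ 2 + b ^ 2 + c ^ 2 - 2 : ℤ) : ℂ) • v) ∧
                  ∃ s : ℤ, (s = a + b + c ∨ s = -(a + b + c)) ∧
                    ∀ Z : (uFormGroup (Fin 2) (Fin 1)).lie,
                      (Z : Matrix (Fin 2 ⊕ Fin 1) (Fin 2 ⊕ Fin 1) ℂ) = Complex.I • (1 : Matrix (Fin 2 ⊕ Fin 1) (Fin 2 ⊕ Fin 1) ℂ) →
                        ∀ v : M, σ𝔤 Z v = ((s : ℂ) * Complex.I) • v) ∧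
      (∀ (L : Type) [Field L] [NumberField L] [IsCMField L] (ι : L →+* ℂ) (H : Matrix (Fin 3) (Fin 3) L) (T : GL (Fin 3) ℂ)
        (hT : (T : Matrix (Fin 3) (Fin 3) ℂ)ᴴ * H.map ι * (T : Matrix (Fin 3) (Fin 3) ℂ) = Literature.Geometry.ComplexHyperbolic.BallModel.J),
        (∀ τ' : L →+* ℂ, InfinitePlace.mk τ' ≠ InfinitePlace.mk ι → (H.map τ').PosDef) →
        2 ≤ Module.finrank ℚ ↥(maximalRealSubfield L) →
        ∀ (μ : Measure (adelicGroupData (↥(maximalRealSubfield L)) L (IsCMField.complexConj L) 3 H).automorphicQuotient)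
          [(adelicGroupData (↥(maximalRealSubfield L)) L (IsCMField.complexConj L) 3 H).IsAutomorphicMeasure μ]
          (μω : HeckeCharacter L) (hμu : μω.IsUnitary),
          (∀ x : Literature.NumberTheory.GaloisRepresentations.ideleGroup ↥(maximalRealSubfield L),
            μω (AdeleRing.ideleBaseChange (↥(maximalRealSubfield L)) L x) = quadraticHeckeCharCM L x) →
        ∀ (P : DiscreteAutomorphicRep (adelicGroupData (↥(maximalRealSubfield L)) L (IsCMField.complexConj L) 3 H) μ),
          (P.IsHolCotangentAt (cmArchSection L ι H T hT) (cmCompactFactor L ι H T hT) ∨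
            P.IsAntiholCotangentAt (cmArchSection L ι H T hT) (cmCompactFactor L ι H T hT)) →
          (∀ k : (adelicGroupData (↥(maximalRealSubfield L)) L (IsCMField.complexConj L) 3 H).Adelic, k ∈ cmCompactFactor L ι H T hT →
            ∀ v : P.space.toSubmodule, (adelicGroupData (↥(maximalRealSubfield L)) L (IsCMField.complexConj L) 3 H).rightRegular μ k
              (v : (adelicGroupData (↥(maximalRealSubfield L)) L (IsCMField.complexConj L) 3 H).L2 μ) = v) →
          ∀ ξ : OneDimAutRepH L,
            MemXiFamily P (transpose_map_cmConjRingHom_eq_of_frame L ι H T hT) (isUnit_det_of_frame L ι H T hT) μω hμu ξ →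
              ∀ τ : L →+* ℂ, InfinitePlace.mk τ ≠ InfinitePlace.mk ι →
                ξ.IsCohTrivialAt (ArchSignRecipe.tOfArchType (archTypeOfRecord μω) τ) τ) :=
  ⟨fun h => ⟨s2Fin_of_S2sharp h, s2GlobalIotaChi_of_S2sharp h, s2PinCompact_of_S2sharp h⟩,
    fun h => s2sharp_of_organs h.1 (pinIota_of_globalIotaChi h.2.1) h.2.2⟩

end Summit.HodgeConjecture.HodgeConjecture.Cruxes.H413.F0P3cS2SharpOrgansOfS2SharpChi

end
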